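import Summits.CriticalPhenomena.CardyFormulaZ2.Theorems.CardyFlipRussoVoronoiHubFromSmirnovHoloUniformBounds
import Summits.CriticalPhenomena.CardyFormulaZ2.Theorems.CardyFlipRussoVoronoiHubFromSmirnovDefectPotential

/-!
# Stub `uniform_defectPackage` of line `moebius-exact-delaunay-dilation-ward`
# (crux `VoronoiHubFromSmirnov`, stmt-CriticalPhenomena-6433)

THE POTENTIAL-DEFECT PACKAGE, UNIFORMLY ON SMALL BALLS CENTRED IN A COMPACT SET (I. Benjamini,
O. Schramm, *Conformal invariance of Voronoi percolation*, Comm. Math. Phys. 197 (1998) 75–107,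
Lemma 4.2, planar case).  The landed brick `defect_implies_potentialDefect` says: for a map `h`
with `C^{1,1}`-conformal data on a convex set `B`, there are constants `W`, `ℓ₀ > 0` such that a
Delaunay pair `p ≠ q` of a locally finite `ω ⊆ B` with small Voronoi cell whose image is NOT a
Delaunay pair of `h '' ω` exhibits a NAVEL or a CLOSE PAIR at tolerance `W ℓ³`.  The one-arm route
applies this square by square at every position of the window, so it needs the constants uniform
over all balls `closedBall x r` centred at the points `x` of a compact set `Kc` inside the open
set `U` on which `g` is holomorphic and injective.  This file is that uniform package.

Proof (pure assembly of two landed facts and compactness; no new definitions).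
1. `holo_uniform_bounds g U Kc` gives `r₁ > 0`, `L ≥ 0`, `0 < m ≤ Λ` and the `C²` data of `g` on
   every `closedBall x r₁`, `x ∈ Kc` (derivatives, `m ≤ ‖g'‖ ≤ Λ`, `‖g''‖ ≤ L`, `g''`
   `L`-Lipschitz), and, for `R₁ = m / (4 (L + 1)) > 0`, an injectivity modulus `η > 0`.
2. For each `x ∈ Kc` the convex ball `B_x = closedBall x r₁` (`convex_closedBall`) satisfies the
   hypotheses of `defect_implies_potentialDefect g g' g'' B_x L m Λ η R₁`, whence constants
   `W_x`, `ℓ₀_x > 0` (`choose`).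
3. Uniformity by compactness: a finite set `t ⊆ Kc` with `Kc ⊆ ⋃_{y ∈ t} ball y (r₁ / 2)`
   (`IsCompact.elim_nhds_subcover`); put `W = ∑_{y ∈ t} |W_y|`, `ℓ₀ = min_{y ∈ t} ℓ₀_y > 0`,
   `r = r₁ / 2` (if `t = ∅` then `Kc = ∅` and everything is vacuous).  For `x ∈ Kc` pick `y ∈ t`
   with `dist x y < r₁ / 2`; then `closedBall x r ⊆ closedBall y r₁ = B_y`, so the package of `y`
   applies (`ℓ ≤ ℓ₀ ≤ ℓ₀_y`), and since `W_y ℓ³ ≤ W ℓ³` its conclusion implies the one with `W`.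
-/

noncomputable section

namespace Summit.CriticalPhenomena.CardyFormulaZ2.Cruxes.VoronoiHubFromSmirnov.MoebiusExactDelaunayDilationWard

open Set Metric

/-- **Uniform potential-defect package** (Benjamini–Schramm 1998, Lemma 4.2, uniformly on small
balls centred in a compact set).  Let `g` be complex-differentiable and injective on the open set
`U ⊆ ℂ` and `Kc ⊆ U` compact.  Then there are `W`, `ℓ₀ > 0`, `r > 0` such that every ball
`closedBall x r` (`x ∈ Kc`) lies in `U`, and for every locally finite `ω ⊆ closedBall x r`, every
Delaunay pair `p ≠ q` of `ω` with `voronoiCell ω p ⊆ closedBall p ℓ`, `0 < ℓ ≤ ℓ₀`,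
`closedBall p (4ℓ) ⊆ closedBall x r`, whose image `g p, g q` is not a Delaunay pair of `g '' ω`,
either a NAVEL (an empty disc through `p`, `q` of radius `≤ ℓ` with two further distinct sites tied
at a distance `< radius + W ℓ³` from its centre) or a CLOSE PAIR (a third site within `W ℓ³` of `p`
or `q`) occurs.  Assembled from `holo_uniform_bounds`, `defect_implies_potentialDefect` and a
finite subcover of `Kc` by half-radius balls. -/
theorem uniform_defectPackage : ∀ (g : ℂ → ℂ) (U Kc : Set ℂ), IsOpen U → IsCompact Kc → Kc ⊆ U → DifferentiableOn ℂ g U → Set.InjOn g U → ∃ W ℓ₀ r : ℝ, 0 < ℓ₀ ∧ 0 < r ∧ (∀ x ∈ Kc, Metric.closedBall x r ⊆ U) ∧ ∀ x ∈ Kc, ∀ (ω : Set ℂ) (p q : ℂ) (ℓ : ℝ), ω ⊆ Metric.closedBall x r → (∀ K : Set ℂ, IsCompact K → (ω ∩ K).Finite) → p ∈ ω → q ∈ ω → p ≠ q → 0 < ℓ → ℓ ≤ ℓ₀ → Metric.closedBall p (4 * ℓ) ⊆ Metric.closedBall x r → Literature.Probability.LatticeModels.voronoiCell ω p ⊆ Metric.closedBall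 p ℓ → Literature.Probability.LatticeModels.IsDelaunayPair ω p q → ¬ Literature.Probability.LatticeModels.IsDelaunayPair (g '' ω) (g p) (g q) → (∃ (x' a b : ℂ), a ∈ ω ∧ b ∈ ω ∧ a ≠ b ∧ a ≠ p ∧ a ≠ q ∧ b ≠ p ∧ b ≠ q ∧ dist p x' = dist q x' ∧ dist p x' ≤ ℓ ∧ (∀ d ∈ ω, dist p x' ≤ dist d x') ∧ dist a x' = dist b x' ∧ dist a x' < dist p x' + W * ℓ ^ 3) ∨ (∃ a ∈ ω, a ≠ p ∧ a ≠ q ∧ (dist a p < W * ℓ ^ 3 ∨ dist a q < W * ℓ ^ 3)) := by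
  intro g U Kc hU hKc hKcU hg hinj
  -- Step 1: the uniform `C²` package of `g` on the balls `closedBall x r₁`, `x ∈ Kc`.
  obtain ⟨r₁, L, m, Λ, hr₁, hL, hm, -, hballU, hder, hLip, hmod⟩ :=
    holo_uniform_bounds g U Kc hU hKc hKcU hg hinj
  have hR₁ : 0 < m / (4 * (L + 1)) := by positivity
  obtain ⟨η, hη, hηle⟩ := hmod (m / (4 * (L + 1))) hR₁
  -- Step 2: the potential-defect package on each ball `closedBall x r₁`, `x ∈ Kc`.
  have key : ∀ x ∈ Kc, ∃ W ℓ₀ : ℝ, 0 < ℓ₀ ∧ ∀ (ω : Set ℂ) (p q : ℂ) (ℓ : ℝ),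
      ω ⊆ closedBall x r₁ → (∀ K : Set ℂ, IsCompact K → (ω ∩ K).Finite) → p ∈ ω → q ∈ ω →
      p ≠ q → 0 < ℓ → ℓ ≤ ℓ₀ → closedBall p (4 * ℓ) ⊆ closedBall x r₁ →
      Literature.Probability.LatticeModels.voronoiCell ω p ⊆ closedBall p ℓ →
      Literature.Probability.LatticeModels.IsDelaunayPair ω p q →
      ¬ Literature.Probability.LatticeModels.IsDelaunayPair (g '' ω) (g p) (g q) →
      (∃ (x' a b : ℂ), a ∈ ω ∧ b ∈ ω ∧ a ≠ b ∧ a ≠ p ∧ a ≠ q ∧ b ≠ p ∧ b ≠ q ∧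
        dist p x' = dist q x' ∧ dist p x' ≤ ℓ ∧ (∀ d ∈ ω, dist p x' ≤ dist d x') ∧
        dist a x' = dist b x' ∧ dist a x' < dist p x' + W * ℓ ^ 3) ∨
      (∃ a ∈ ω, a ≠ p ∧ a ≠ q ∧ (dist a p < W * ℓ ^ 3 ∨ dist a q < W * ℓ ^ 3)) := by
    intro x hx
    exact defect_implies_potentialDefect g (deriv g) (deriv (deriv g)) (closedBall x r₁) L m Λ η
      (m / (4 * (L + 1))) (convex_closedBall x r₁) hm hη hR₁ le_rfl
      (fun z hz => (hder x hx z hz).1) (fun z hz => (hder x hx z hz).2.1)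
      (fun z hz => (hder x hx z hz).2.2.1) (fun z hz => (hder x hx z hz).2.2.2.1)
      (fun z hz => (hder x hx z hz).2.2.2.2) (hLip x hx) (hηle x hx)
  choose! W ℓ₀ hℓ₀ hP using key
  -- Step 3: a finite subcover of `Kc` by the half-radius balls `ball y (r₁ / 2)`, `y ∈ Kc`.
  obtain ⟨t, htK, hcov⟩ := hKc.elim_nhds_subcover (fun x => ball x (r₁ / 2))
    fun x _ => ball_mem_nhds x (half_pos hr₁)
  rcases t.eq_empty_or_nonempty with ht | ht
  · -- `t = ∅` forces `Kc = ∅`: the statement is vacuous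
    have hKe : ∀ x, x ∉ Kc := fun x hx => by simpa [ht] using hcov hx
    exact ⟨0, 1, r₁, one_pos, hr₁, fun x hx => (hKe x hx).elim, fun x hx => (hKe x hx).elim⟩
  refine ⟨∑ y ∈ t, |W y|, t.inf' ht ℓ₀, r₁ / 2,
    (Finset.lt_inf'_iff ht).2 fun y hy => hℓ₀ y (htK y hy), half_pos hr₁, ?_, ?_⟩
  · -- the half-radius balls lie in `U`
    intro x hx
    exact (closedBall_subset_closedBall (by linarith)).trans (hballU x hx)
  · intro x hx ω p q ℓ hω hfin hp hq hpq hℓ hℓle h4 hcell hDel hndel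
    obtain ⟨y, hy, hxy⟩ : ∃ y ∈ t, x ∈ ball y (r₁ / 2) := by
      simpa only [mem_iUnion, exists_prop] using hcov hx
    have hyK : y ∈ Kc := htK y hy
    have hsub : closedBall x (r₁ / 2) ⊆ closedBall y r₁ :=
      closedBall_subset_closedBall' (by rw [mem_ball] at hxy; linarith)
    have hℓy : ℓ ≤ ℓ₀ y := hℓle.trans (Finset.inf'_le _ hy)
    have hWy : W y * ℓ ^ 3 ≤ (∑ z ∈ t, |W z|) * ℓ ^ 3 :=
      mul_le_mul_of_nonneg_right
        ((le_abs_self _).trans (Finset.single_le_sum (fun z _ => abs_nonneg (W z)) hy))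
        (by positivity)
    rcases hP y hyK ω p q ℓ (hω.trans hsub) hfin hp hq hpq hℓ hℓy (h4.trans hsub) hcell hDel
        hndel with ⟨x', a, b, ha, hb, hab, hap, haq, hbp, hbq, hpx, hpxl, hmin, habx, hlt⟩ |
      ⟨a, ha, hap, haq, hclose⟩
    · exact Or.inl ⟨x', a, b, ha, hb, hab, hap, haq, hbp, hbq, hpx, hpxl, hmin, habx,
        hlt.trans_le (by linarith)⟩
    · exact Or.inr ⟨a, ha, hap, haq, hclose.imp (fun h => h.trans_le hWy) fun h => h.trans_le hWy⟩

end Summit.CriticalPhenomena.CardyFormulaZ2.Cruxes.VoronoiHubFromSmirnov.MoebiusExactDelaunayDilationWard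

end
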